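import Summits.BirchSwinnertonDyer.BirchSwinnertonDyer.Theorems.ManinLocalTwoThreeKummerWitnessInvarianceDensity
import Summits.BirchSwinnertonDyer.BirchSwinnertonDyer.Theorems.ManinLocalTwoThreeKummerCubeRootCuspGrowth
import Summits.BirchSwinnertonDyer.Rank1Residual.ManinAdditive.UDCKummerWitnessLineB
import Literature.NumberTheory.EllipticCurves.ModularCurveManinConstantProofs
import HarnessLib

/-!
# (INVB) PROVED: the `Γ₀(N)`-stabiliser of the B-witness `C₀·B_d·kummerMinBlock` is exactly the Kummer group
(route `ManinLocalTwoThree`, crux C3 `ManinPrimeToThreeAtNine` stmt-BirchSwinnertonDyer-22968; cell bsd-f2-manin, p2 gen 17;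
`--supports stmt-BirchSwinnertonDyer-22968`)

**`kummerMinimalWitnessInvarianceB_holds : UDCKummerWitnessLine.KummerMinimalWitnessInvarianceB`** — -an g38's typed B-line piece (INVB)
(`UDCKummerWitnessLineB.lean`, p730675), BY NAME: for `u ∉ Λ`, `3u = m₁ω₁ + m₂ω₂`, a non-zero `B_d ∈ M_{12m}(Γ₀(N))`, `C₀ ≠ 0` and a holomorphic `F`
equal to `C₀·B_d·kummerMinBlock D u e` on the good set `{w ∉ Λ, y_W∘φ ≠ 0}`, and `γ ∈ Γ₀(N)`: `KummerPeriodTrivial D u γ ⟺ F ∣[12m] γ = F`.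
Same proof as (INV) (`…KummerWitnessInvariance.lean`, p731378) with `B_d(γτ) = (cτ+d)^{12m}B_d(τ)` (Mathlib `slash_action_eqn_SL''`) in place of the
pole killer, and `F ≢ 0` from the isolated zeros of `B_d` (AN2-d `eventually_ne_zero_of_mdifferentiable`) and of `σ·Q·A` along `w` ((INV-b)).
HONEST FRAMING.  One typed piece of the B-line is now a theorem; (DICT), (RATB), (HOLB), (QEXNB) remain ((INT), (QXP) closed by name).  BSD is not
proved by this; Manin's conjecture is not proved; C2 and C3 remain OPEN.
[folklore]
-/

set_option autoImplicit false
-- lint-debt: the directory name repeats the summit name (sibling precedent `ManinLocalTwoThreeKummerWitnessInvariance.lean`)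
set_option linter.dupNamespace false

noncomputable section

open scoped Topology PeriodPair MatrixGroups Manifold ModularForm
open Complex Filter CongruenceSubgroup
open UpperHalfPlane hiding I
open Literature.NumberTheory.EllipticCurves Literature.NumberTheory.EllipticCurves.ModularForms
open Summit.BirchSwinnertonDyer.Rank1Residual.ManinAdditive.KummerCubeMonodromy
open Summit.BirchSwinnertonDyer.Rank1Residual.ManinAdditive.UDCKummerLine
open Summit.BirchSwinnertonDyer.Rank1Residual.ManinAdditive.UDCKummerWitnessLine
open Summit.BirchSwinnertonDyer.BirchSwinnertonDyer.Theorems.ManinLocalTwoThree.KummerCubeRootDictionary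
open Summit.BirchSwinnertonDyer.BirchSwinnertonDyer.Theorems.ManinLocalTwoThree.KummerCover

namespace Summit.BirchSwinnertonDyer.BirchSwinnertonDyer.Theorems.ManinLocalTwoThree.WitnessInvariance

variable {W : WeierstrassCurve ℚ} {N : ℕ} [NeZero N]

/-! ### §1 The slash of the B-witness -/

/-- On the good set, `(F ∣[12m] γ)(τ) = ρ·F(τ)` for `F = C₀·B_d·block` there and any multiplier `ρ` of `W_{u,e}` along `μ_γ`. [folklore] -/
theorem slashB_apply_eq_mul_of_good (D : ModularParametrizationData W N) (u e : ℂ) {m : ℕ} (Bd : ModularForm (Gamma0 N) (12 * (m : ℤ)))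
    (C₀ : ℂ) {F : ℍ → ℂ}
    (hF : ∀ τ : ℍ, (D.c : ℂ) * eichlerIntegral D.f τ ∉ D.L.lattice → minimalY D τ ≠ 0 →
      F τ = C₀ * Bd τ * kummerMinBlock D u e τ)
    (γ : Gamma0 N) {ρ : ℂ} (hρ : ∀ w : ℂ, sigmaCubeRoot D.L u e (w + (D.c : ℂ) * cuspSymbol D.f γ) = ρ * sigmaCubeRoot D.L u e w)
    (τ : ℍ) (hw : (D.c : ℂ) * eichlerIntegral D.f τ ∉ D.L.lattice) (hY : minimalY D τ ≠ 0) :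
    (F ∣[(12 * (m : ℤ))] (γ : SL(2, ℤ))) τ = ρ * F τ := by
  rw [ModularForm.SL_slash_apply]
  have hw' : (D.c : ℂ) * eichlerIntegral D.f ((γ : SL(2, ℤ)) • τ) ∉ D.L.lattice := (smul_eichlerIntegral_notMem_iff D γ τ).mpr hw
  have hY' : minimalY D ((γ : SL(2, ℤ)) • τ) ≠ 0 := by rwa [minimalY_gamma_smul]
  have hd : denom (γ : SL(2, ℤ)) τ ≠ 0 := denom_ne_zero _ τ
  have hBd : Bd ((γ : SL(2, ℤ)) • τ) = denom (γ : SL(2, ℤ)) τ ^ (12 * (m : ℤ)) * Bd τ :=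
    SlashInvariantForm.slash_action_eqn_SL'' Bd γ.2 τ
  rw [hF _ hw' hY', hF τ hw hY, kummerMinBlock_gamma_smul_of_multiplier D u e γ hρ, hBd, zpow_neg]
  field_simp

/-- **`F ∣[12m] γ = ρ·F` everywhere** (good set by §1, the isolated bad points by continuity). [folklore] -/
theorem slashB_eq_smul (D : ModularParametrizationData W N) (hc0 : D.c ≠ 0) (hf : D.f ≠ 0) (u e : ℂ) {m : ℕ}
    (Bd : ModularForm (Gamma0 N) (12 * (m : ℤ))) (C₀ : ℂ) {F : ℍ → ℂ} (hFd : MDifferentiable 𝓘(ℂ) 𝓘(ℂ) F)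
    (hF : ∀ τ : ℍ, (D.c : ℂ) * eichlerIntegral D.f τ ∉ D.L.lattice → minimalY D τ ≠ 0 →
      F τ = C₀ * Bd τ * kummerMinBlock D u e τ)
    (γ : Gamma0 N) {ρ : ℂ} (hρ : ∀ w : ℂ, sigmaCubeRoot D.L u e (w + (D.c : ℂ) * cuspSymbol D.f γ) = ρ * sigmaCubeRoot D.L u e w) :
    F ∣[(12 * (m : ℤ))] (γ : SL(2, ℤ)) = ρ • F := by
  funext τ₀
  have hG : MDifferentiable 𝓘(ℂ) 𝓘(ℂ) (F ∣[(12 * (m : ℤ))] (γ : SL(2, ℤ))) := by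
    rw [ModularForm.SL_slash]
    exact hFd.slash _ _
  have h1 : ContinuousAt ((F ∣[(12 * (m : ℤ))] (γ : SL(2, ℤ))) ∘ ofComplex) (τ₀ : ℂ) :=
    (UpperHalfPlane.mdifferentiableAt_iff.mp (hG τ₀)).continuousAt
  have h2 : ContinuousAt (fun z : ℂ => ρ * (F ∘ ofComplex) z) (τ₀ : ℂ) :=
    continuousAt_const.mul (UpperHalfPlane.mdifferentiableAt_iff.mp (hFd τ₀)).continuousAt
  have heq : ((F ∣[(12 * (m : ℤ))] (γ : SL(2, ℤ))) ∘ ofComplex) =ᶠ[𝓝[≠] (τ₀ : ℂ)] fun z : ℂ => ρ * (F ∘ ofComplex) z := by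
    filter_upwards [eventually_good D hc0 hf τ₀] with z hz
    simp only [Function.comp_apply]
    exact slashB_apply_eq_mul_of_good D u e Bd C₀ hF γ hρ (ofComplex z) hz.1 hz.2
  have hlim := tendsto_nhds_unique_of_eventuallyEq (h1.tendsto.mono_left nhdsWithin_le_nhds)
    (h2.tendsto.mono_left nhdsWithin_le_nhds) heq
  simpa only [Function.comp_apply, ofComplex_apply, Pi.smul_apply, smul_eq_mul] using hlim

/-! ### §2 The B-witness is not identically zero -/

/-- **`F ≢ 0`** for `F = C₀·B_d·block` on the good set with `C₀ ≠ 0`, `B_d ≠ 0`. [folklore] -/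
theorem exists_apply_ne_zero_B (D : ModularParametrizationData W N) (hc0 : D.c ≠ 0) (hf : D.f ≠ 0) {u : ℂ} (hu : u ∉ D.L.lattice)
    (e : ℂ) {m : ℕ} {Bd : ModularForm (Gamma0 N) (12 * (m : ℤ))} (hBd : Bd ≠ 0) {C₀ : ℂ} (hC₀ : C₀ ≠ 0) {F : ℍ → ℂ}
    (hF : ∀ τ : ℍ, (D.c : ℂ) * eichlerIntegral D.f τ ∉ D.L.lattice → minimalY D τ ≠ 0 →
      F τ = C₀ * Bd τ * kummerMinBlock D u e τ) :
    ∃ τ : ℍ, F τ ≠ 0 := by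
  by_contra hcon
  simp only [not_exists, not_not] at hcon
  obtain ⟨Q, A, hQd, hAd, hQ0, hA0, hY, hblock⟩ := exists_minimal_package D hc0 u e
  have hc : (D.c : ℂ) ≠ 0 := Int.cast_ne_zero.mpr hc0
  have hσ : Differentiable ℂ D.L.weierstrassSigma := D.L.differentiable_weierstrassSigma_holds
  have hσu : D.L.weierstrassSigma (-u) ≠ 0 := fun h =>
    hu (by simpa using D.L.lattice.neg_mem ((D.L.weierstrassSigma_eq_zero_iff_holds (-u)).mp h))
  have hZ : Differentiable ℂ (fun w => D.L.weierstrassSigma w * (Q w * A w)) := hσ.mul (hQd.mul hAd)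
  have hne : ∃ w, D.L.weierstrassSigma w * (Q w * A w) ≠ 0 :=
    exists_sigma_mul_ne_zero D.L (hQd.mul hAd).continuous.continuousAt (by
      show Q 0 * A 0 ≠ 0
      rw [hQ0, hA0]; exact mul_ne_zero (by norm_num) hσu)
  -- a point where `B_d ≠ 0` too
  have hBdne : ∃ τ : ℍ, Bd τ ≠ 0 := by
    by_contra h0
    simp only [not_exists, not_not] at h0
    exact hBd (DFunLike.ext Bd 0 fun τ => by rw [h0 τ]; rfl)
  have hev := (eventually_comp_ne_zero D hc0 hf UpperHalfPlane.I hZ hne).and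
    (eventually_ne_zero_of_mdifferentiable (ModularFormClass.holo Bd) hBdne UpperHalfPlane.I)
  obtain ⟨z, hz, hBz⟩ := hev.exists
  set w : ℂ := (D.c : ℂ) * eichlerIntegral D.f (ofComplex z) with hw_def
  have hσw : D.L.weierstrassSigma w ≠ 0 := left_ne_zero_of_mul hz
  have hQw : Q w ≠ 0 := left_ne_zero_of_mul (right_ne_zero_of_mul hz)
  have hAw : A w ≠ 0 := right_ne_zero_of_mul (right_ne_zero_of_mul hz)
  have hw : w ∉ D.L.lattice := fun h => hσw ((D.L.weierstrassSigma_eq_zero_iff_holds _).mpr h)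
  have hYne : minimalY D (ofComplex z) ≠ 0 := by
    rw [hY _ hw]
    exact div_ne_zero (mul_ne_zero (div_ne_zero (pow_ne_zero 3 hc) two_ne_zero) hQw) (pow_ne_zero 3 hσw)
  have hFz := hF (ofComplex z) hw hYne
  rw [hcon, hblock _ hw hQw] at hFz
  have hblock_ne : -2 * A w * cexp (e * w / 3) / Q w ≠ 0 :=
    div_ne_zero (mul_ne_zero (mul_ne_zero (by norm_num) hAw) (Complex.exp_ne_zero _)) hQw
  have hBz' : Bd (ofComplex z) ≠ 0 := hBz
  exact hblock_ne ((mul_eq_zero.mp hFz.symm).resolve_left (mul_ne_zero hC₀ hBz'))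

/-! ### §3 (INVB) by name -/

/-- **(INVB) `KummerMinimalWitnessInvarianceB` holds.**  See the file header. [folklore] -/
theorem kummerMinimalWitnessInvarianceB_holds : KummerMinimalWitnessInvarianceB := by
  intro W _ _ N _ D u hu m₁ m₂ h3u m Bd hBd C₀ hC₀ F hFd hF γ
  have hc0 : D.c ≠ 0 := D.maninConstant_ne_zero_holds
  have hf : D.f ≠ 0 := newform_ne_zero D
  have h3u' : (m₁ : ℂ) * D.L.ω₁ + (m₂ : ℂ) * D.L.ω₂ = 3 * u := h3u.symm
  have hμ := smul_cuspSymbol_mem_lattice D γ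
  obtain ⟨ρ, hρW, -⟩ := exists_multiplier_gamma D u (m₁ * D.L.η₁ + m₂ * D.L.η₂) γ
  constructor
  · intro hK
    have hper := (sigmaCubeRoot_periodic_iff D.L hu h3u' hμ).mpr hK
    have h := slashB_eq_smul D hc0 hf u (m₁ * D.L.η₁ + m₂ * D.L.η₂) Bd C₀ hFd hF γ (ρ := 1)
      (fun w => by rw [hper w, one_mul])
    rw [h, one_smul]
  · intro hinv
    have hρF := slashB_eq_smul D hc0 hf u (m₁ * D.L.η₁ + m₂ * D.L.η₂) Bd C₀ hFd hF γ hρW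
    obtain ⟨τ₁, hτ₁⟩ := exists_apply_ne_zero_B D hc0 hf hu (m₁ * D.L.η₁ + m₂ * D.L.η₂) hBd hC₀ hF
    have hρ1 : ρ = 1 := by
      have h := congrFun hρF τ₁
      rw [hinv, Pi.smul_apply, smul_eq_mul] at h
      have h' : (ρ - 1) * F τ₁ = 0 := by linear_combination -h
      exact sub_eq_zero.mp ((mul_eq_zero.mp h').resolve_right hτ₁)
    refine (sigmaCubeRoot_periodic_iff D.L hu h3u' hμ).mp fun w => ?_
    rw [hρW w, hρ1, one_mul]

end Summit.BirchSwinnertonDyer.BirchSwinnertonDyer.Theorems.ManinLocalTwoThree.WitnessInvariance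

end
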